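import Summits.QuantumFields.BalabanUV.T4Continuum.Support.AveragingDeficitTransportCalc

/-!
# AveragingDeficitPushForwardLinear (T⁴ programme, node NE3, row NE3-R2, gen 2) — THE DIFFERENTIAL OF BAŁABAN'S AVERAGE
# (42) IS LINEAR AND LOCAL IN THE DIRECTION: `pushDir L V (ψ₁ + ψ₂) = pushDir L V ψ₁ + pushDir L V ψ₂`,
# `pushDir L V (c•ψ) = c • pushDir L V ψ` (inside the small-field class), and `pushDir L V ψ (c)` depends on `ψ` only
# through its values on the bonds of the contours `Γ_{c,x} ∪ (−Γ_c)` and `Γ_c` of the coarse bond `c` (file 2/3 of the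
# non-abelian lift γ; file 1 = `AveragingDeficitTransportCalc`, file 3 = the face-bond lift)

HONEST FRAMING (cell `pub-balaban`, T4-DAG PAGE 1; unit `b2b-balaban-t4-ne3r2-p1` = owner of BINDER-OWNERS row NE3-R2,
gen 2).  The cell's T4 target is the finite-torus continuum limit of the unit-scale averaged loop expectations — NOT
infinite volume, NO mass gap, NOT Clay, NOT summit progress.  The lift γ of the NE3 energy route (record
`t4/T4-EST-NE3-P2.md` §4 (γ1); input `TangentLift` of `T4ConvexResponse.dualResidual_le`) asks for a bounded right
inverse of the differential `ψ ↦ Φ = pushDir L V ψ` of the non-linear average (42) (`AveragingDeficitResidualPairing.pushDir`,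
this unit).  Session 1 defined the derivative of the logarithm of the loop variables as a `deriv`
(`AveragingDeficitSideDeriv.mlogDeriv`), so linearity in the direction is a THEOREM, not a syntactic fact: it follows from
the loop identity `J_{log W}((log W_s)′) = Ad_{W⁻¹}(δ_ψV)(loop)` (session 1's `jexp_mlog_eq_Ad`), the linearity of
`(δ_ψV)(Γ)` in `ψ`, and the injectivity of `J_X` near the identity (file 1).  WHAT IS HERE (all [folklore], 0 sorry):
§1 two-direction locality `hol_vary_congr` / `Wcx_vary_congr` / `mlogDeriv_congr` / `XavgDeriv_congr` / `sideDeriv_congr` /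
**`pushDir_congr`** (directions agreeing on the bonds of the loops `Γ_{c,x} ∪ (−Γ_c)`, `x ∈ B(c₋)`, and of `Γ_c` have the
same push-forward at `c`); §2 linearity `mlogDeriv_add/smul`, `XavgDeriv_add/smul`, `sideDeriv_add/smul`,
**`pushDir_add` / `pushDir_smul`** under `|V(Γ_{c,x})V(c)⁻¹ − 1| ≤ 1/32` for all `x ∈ B(c₋)` (the small-field regime of
B7 p. 25, tree `B7Prop2Explicit.norm_Wcx_sub_one_le`).  NE3 ITSELF IS NOT PROVED (energy route: NE3(A) ⇐ ML ∧ R0 ∧ β ∧ γ);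
NE3 stays COND-free.
CITATION HEADER: no printed sentence is a hypothesis; the manuscripts under audit are not cited for any disputed step;
context: T. Bałaban, Commun. Math. Phys. **98** (1985) 17–51 [Balaban1985Averaging] ((9) p. 18, (21) p. 21, (42) p. 23,
p. 25).  PLACEMENT: `Summits/QuantumFields/BalabanUV/` (human rule 2026-08-19).  Record: HOME `t4/T4-EST-NE3-R2.md` v0.3.
-/

set_option autoImplicit false

open scoped BigOperators Matrix Matrix.Norms.L2Operator Topology
open NormedSpace Finset Filter

namespace Summit.QuantumFields.BalabanUV.T4Continuum.AveragingDeficitPushForwardLinear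

open Literature.MathematicalPhysics.QuantumFieldTheory.Balaban1983to89
open B7Prop1Explicit B7Prop2Explicit MatrixLog UnitaryModel
open T4AveragingDeficitWall hiding Site Plane Plaq Bond
open T4AveragingDeficitNonAbelian (Ad_mul Ad_sub)
open AveragingDeficitTransport AveragingDeficitLocality AveragingDeficitNearIdentity AveragingDeficitSideDeriv
open AveragingDeficitResidualPairing AveragingDeficitTransportCalc

noncomputable section

variable {d : ℕ} {n : Type*} [Fintype n] [DecidableEq n]

local notation "𝕄" => Matrix n n ℂ
local notation "Site" => B7Prop1Explicit.Site

/-! ## §1 Locality: the push-forward at `c` sees the direction only on the bonds of the contours of `c` -/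

/-- A letter's transport along `V e^{sψ}` depends on `ψ` only at its bond. [folklore] -/
theorem stepHol_vary_congr (V : Site d → Fin d → 𝕄ˣ) {ψ ψ' : Site d → Fin d → 𝕄} (x : Site d) (l : Letter d)
    (h : ψ (if l.2 then x else x + l.vec) l.1 = ψ' (if l.2 then x else x + l.vec) l.1) (s : ℝ) :
    stepHol (vary V ψ s) x l = stepHol (vary V ψ' s) x l := by
  obtain ⟨μ, b⟩ := l
  cases b
  · simp only [Bool.false_eq_true, ↓reduceIte] at h
    simp only [stepHol, Bool.false_eq_true, ↓reduceIte, vary, h]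
  · simp only [↓reduceIte] at h
    simp only [stepHol, ↓reduceIte, vary, h]

/-- **Two-direction locality of (9)**: directions agreeing on the bonds of the word give the same transport along
`V e^{sψ}`. [folklore] -/
theorem hol_vary_congr (V : Site d → Fin d → 𝕄ˣ) {ψ ψ' : Site d → Fin d → 𝕄} (s : ℝ) :
    ∀ (x : Site d) (w : List (Letter d)), (∀ b ∈ bondsOf x w, ψ b.1 b.2 = ψ' b.1 b.2) →
      hol (vary V ψ s) x w = hol (vary V ψ' s) x w
  | x, [], _ => by simp
  | x, l :: w, h => by
    rw [hol_cons, hol_cons, hol_vary_congr V s (x + l.vec) w fun b hb => h b (by simp [hb]),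
      stepHol_vary_congr V x l ?_ s]
    have := h (if l.2 then (x, l.1) else (x + l.vec, l.1)) (by simp)
    obtain ⟨μ, b⟩ := l
    cases b <;> simpa using this

/-- Locality of the loop variable of (42) in the direction. [cite: Balaban1985Averaging, (42) p.23] -/
theorem Wcx_vary_congr (L : ℕ) (V : Site d → Fin d → 𝕄ˣ) {ψ ψ' : Site d → Fin d → 𝕄} (s : ℝ) (q : Site d)
    (κ : Fin d) (r : Site d) (h : ∀ b ∈ bondsOf q (loopWord L κ r), ψ b.1 b.2 = ψ' b.1 b.2) :
    Wcx L (vary V ψ s) q κ r = Wcx L (vary V ψ' s) q κ r := by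
  rw [Wcx_eq_hol_loop, Wcx_eq_hol_loop]
  exact hol_vary_congr V s q _ h

/-- Locality of `(log W_s)′` in the direction. [folklore] -/
theorem mlogDeriv_congr (L : ℕ) (V : Site d → Fin d → 𝕄ˣ) {ψ ψ' : Site d → Fin d → 𝕄} (q : Site d) (κ : Fin d)
    (r : Site d) (h : ∀ b ∈ bondsOf q (loopWord L κ r), ψ b.1 b.2 = ψ' b.1 b.2) :
    mlogDeriv L V ψ q κ r = mlogDeriv L V ψ' q κ r := by
  unfold mlogDeriv
  congr 1
  funext s
  rw [Wcx_vary_congr L V s q κ r h]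

/-- Locality of `X_c′` in the direction. [folklore] -/
theorem XavgDeriv_congr (L : ℕ) (V : Site d → Fin d → 𝕄ˣ) {ψ ψ' : Site d → Fin d → 𝕄} (q : Site d) (κ : Fin d)
    (h : ∀ (r : Fin d → Fin L), ∀ b ∈ bondsOf q (loopWord L κ (boxVec L r)), ψ b.1 b.2 = ψ' b.1 b.2) :
    XavgDeriv L V ψ q κ = XavgDeriv L V ψ' q κ := by
  unfold XavgDeriv
  exact Finset.sum_congr rfl fun r _ => by rw [mlogDeriv_congr L V q κ _ (h r)]

/-- Locality of `δV̄(c)` in the direction. [folklore] -/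
theorem sideDeriv_congr (L : ℕ) (V : Site d → Fin d → 𝕄ˣ) {ψ ψ' : Site d → Fin d → 𝕄} (q : Site d) (κ : Fin d)
    (hloop : ∀ (r : Fin d → Fin L), ∀ b ∈ bondsOf q (loopWord L κ (boxVec L r)), ψ b.1 b.2 = ψ' b.1 b.2)
    (hseg : ∀ b ∈ bondsOf q (seg κ (L : ℤ)), ψ b.1 b.2 = ψ' b.1 b.2) :
    sideDeriv L V ψ q κ = sideDeriv L V ψ' q κ := by
  unfold sideDeriv
  rw [XavgDeriv_congr L V q κ hloop, dhol_congr V q _ hseg]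

/-- **LOCALITY OF THE PUSH-FORWARD**: directions agreeing on the bonds of all loops `Γ_{c,x} ∪ (−Γ_c)` and of `Γ_c` have
the same push-forward `Φ(c)`. [cite: Balaban1985Averaging, (42) p.23] -/
theorem pushDir_congr (L : ℕ) (V : Site d → Fin d → 𝕄ˣ) {ψ ψ' : Site d → Fin d → 𝕄} (q : Site d) (κ : Fin d)
    (hloop : ∀ (r : Fin d → Fin L), ∀ b ∈ bondsOf q (loopWord L κ (boxVec L r)), ψ b.1 b.2 = ψ' b.1 b.2)
    (hseg : ∀ b ∈ bondsOf q (seg κ (L : ℤ)), ψ b.1 b.2 = ψ' b.1 b.2) :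
    pushDir L V ψ q κ = pushDir L V ψ' q κ := by
  unfold pushDir
  rw [sideDeriv_congr L V q κ hloop hseg]

/-! ## §2 Linearity of the differential of (42) in the direction -/

/-- In the regime `|W − 1| ≤ 1/32`: the ball condition and `15|log W| < 1`. [folklore] -/
theorem small_regime {W : 𝕄} (hW : ‖W - 1‖ ≤ 1 / 32) : ‖W - 1‖ < 1 ∧ 15 * ‖mlog W‖ < 1 := by
  refine ⟨by linarith, ?_⟩
  have h := norm_mlog_le_two_mul (X := W) (by linarith)
  linarith

/-- **`(log W_s)′` is additive in the direction** (loop identity + injectivity of `J_{log W}`). [folklore] -/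
theorem mlogDeriv_add (L : ℕ) (V : Site d → Fin d → 𝕄ˣ) (ψ₁ ψ₂ : Site d → Fin d → 𝕄) (q : Site d) (κ : Fin d)
    (r : Fin d → Fin L) (hW : ‖((Wcx L V q κ (boxVec L r) : 𝕄ˣ) : 𝕄) - 1‖ ≤ 1 / 32) :
    mlogDeriv L V (ψ₁ + ψ₂) q κ (boxVec L r) = mlogDeriv L V ψ₁ q κ (boxVec L r) + mlogDeriv L V ψ₂ q κ (boxVec L r) := by
  obtain ⟨hW1, hX⟩ := small_regime hW
  refine jexp_injective _ hX ?_
  rw [jexp_add, jexp_mlog_eq_Ad L V _ q κ r hW1, jexp_mlog_eq_Ad L V _ q κ r hW1, jexp_mlog_eq_Ad L V _ q κ r hW1,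
    dhol_add, Ad_add]

/-- **`(log W_s)′` is real-homogeneous in the direction**. [folklore] -/
theorem mlogDeriv_smul (L : ℕ) (V : Site d → Fin d → 𝕄ˣ) (c : ℝ) (ψ : Site d → Fin d → 𝕄) (q : Site d) (κ : Fin d)
    (r : Fin d → Fin L) (hW : ‖((Wcx L V q κ (boxVec L r) : 𝕄ˣ) : 𝕄) - 1‖ ≤ 1 / 32) :
    mlogDeriv L V (c • ψ) q κ (boxVec L r) = c • mlogDeriv L V ψ q κ (boxVec L r) := by
  obtain ⟨hW1, hX⟩ := small_regime hW
  refine jexp_injective _ hX ?_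
  rw [jexp_smul, jexp_mlog_eq_Ad L V _ q κ r hW1, jexp_mlog_eq_Ad L V _ q κ r hW1, dhol_smul, Ad_real_smul]

/-- `X_c′` is additive in the direction. [folklore] -/
theorem XavgDeriv_add (L : ℕ) (V : Site d → Fin d → 𝕄ˣ) (ψ₁ ψ₂ : Site d → Fin d → 𝕄) (q : Site d) (κ : Fin d)
    (hW : ∀ r : Fin d → Fin L, ‖((Wcx L V q κ (boxVec L r) : 𝕄ˣ) : 𝕄) - 1‖ ≤ 1 / 32) :
    XavgDeriv L V (ψ₁ + ψ₂) q κ = XavgDeriv L V ψ₁ q κ + XavgDeriv L V ψ₂ q κ := by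
  unfold XavgDeriv
  rw [← Finset.sum_add_distrib]
  exact Finset.sum_congr rfl fun r _ => by rw [mlogDeriv_add L V ψ₁ ψ₂ q κ r (hW r), smul_add]

/-- `X_c′` is real-homogeneous in the direction. [folklore] -/
theorem XavgDeriv_smul (L : ℕ) (V : Site d → Fin d → 𝕄ˣ) (c : ℝ) (ψ : Site d → Fin d → 𝕄) (q : Site d) (κ : Fin d)
    (hW : ∀ r : Fin d → Fin L, ‖((Wcx L V q κ (boxVec L r) : 𝕄ˣ) : 𝕄) - 1‖ ≤ 1 / 32) :
    XavgDeriv L V (c • ψ) q κ = c • XavgDeriv L V ψ q κ := by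
  unfold XavgDeriv
  rw [Finset.smul_sum]
  exact Finset.sum_congr rfl fun r _ => by rw [mlogDeriv_smul L V c ψ q κ r (hW r), smul_comm]

/-- `δV̄(c)` is additive in the direction. [folklore] -/
theorem sideDeriv_add (L : ℕ) (V : Site d → Fin d → 𝕄ˣ) (ψ₁ ψ₂ : Site d → Fin d → 𝕄) (q : Site d) (κ : Fin d)
    (hW : ∀ r : Fin d → Fin L, ‖((Wcx L V q κ (boxVec L r) : 𝕄ˣ) : 𝕄) - 1‖ ≤ 1 / 32) :
    sideDeriv L V (ψ₁ + ψ₂) q κ = sideDeriv L V ψ₁ q κ + sideDeriv L V ψ₂ q κ := by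
  unfold sideDeriv
  rw [XavgDeriv_add L V ψ₁ ψ₂ q κ hW, jexp_add, dhol_add, ← Ad_add]
  congr 1
  abel

/-- `δV̄(c)` is real-homogeneous in the direction. [folklore] -/
theorem sideDeriv_smul (L : ℕ) (V : Site d → Fin d → 𝕄ˣ) (c : ℝ) (ψ : Site d → Fin d → 𝕄) (q : Site d) (κ : Fin d)
    (hW : ∀ r : Fin d → Fin L, ‖((Wcx L V q κ (boxVec L r) : 𝕄ˣ) : 𝕄) - 1‖ ≤ 1 / 32) :
    sideDeriv L V (c • ψ) q κ = c • sideDeriv L V ψ q κ := by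
  unfold sideDeriv
  rw [XavgDeriv_smul L V c ψ q κ hW, jexp_smul, dhol_smul, ← smul_add, Ad_real_smul]

/-- **THE DIFFERENTIAL OF (42) IS ADDITIVE IN THE DIRECTION** (small-field regime `|V(Γ_{c,x})V(c)⁻¹ − 1| ≤ 1/32`).
[cite: Balaban1985Averaging, (42) p.23, p.25] -/
theorem pushDir_add (L : ℕ) (V : Site d → Fin d → 𝕄ˣ) (ψ₁ ψ₂ : Site d → Fin d → 𝕄) (q : Site d) (κ : Fin d)
    (hW : ∀ r : Fin d → Fin L, ‖((Wcx L V q κ (boxVec L r) : 𝕄ˣ) : 𝕄) - 1‖ ≤ 1 / 32) :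
    pushDir L V (ψ₁ + ψ₂) q κ = pushDir L V ψ₁ q κ + pushDir L V ψ₂ q κ := by
  unfold pushDir
  rw [sideDeriv_add L V ψ₁ ψ₂ q κ hW, Ad_add]

/-- **THE DIFFERENTIAL OF (42) IS REAL-HOMOGENEOUS IN THE DIRECTION**. [cite: Balaban1985Averaging, (42) p.23, p.25] -/
theorem pushDir_smul (L : ℕ) (V : Site d → Fin d → 𝕄ˣ) (c : ℝ) (ψ : Site d → Fin d → 𝕄) (q : Site d) (κ : Fin d)
    (hW : ∀ r : Fin d → Fin L, ‖((Wcx L V q κ (boxVec L r) : 𝕄ˣ) : 𝕄) - 1‖ ≤ 1 / 32) :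
    pushDir L V (c • ψ) q κ = c • pushDir L V ψ q κ := by
  unfold pushDir
  rw [sideDeriv_smul L V c ψ q κ hW, Ad_real_smul]

/-- The zero direction pushes forward to zero. [folklore] -/
theorem pushDir_zero (L : ℕ) (V : Site d → Fin d → 𝕄ˣ) (q : Site d) (κ : Fin d)
    (hW : ∀ r : Fin d → Fin L, ‖((Wcx L V q κ (boxVec L r) : 𝕄ˣ) : 𝕄) - 1‖ ≤ 1 / 32) :
    pushDir L V (0 : Site d → Fin d → 𝕄) q κ = 0 := by
  have h := pushDir_smul L V (0 : ℝ) (0 : Site d → Fin d → 𝕄) q κ hW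
  rwa [zero_smul, zero_smul] at h

end

end Summit.QuantumFields.BalabanUV.T4Continuum.AveragingDeficitPushForwardLinear
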